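import Summits.QuantumFields.YangMills.Theorems.ColdStartUniversalityLatticeLangevinGradientBoundFlow
import Summits.QuantumFields.YangMills.Theorems.ColdStartUniversalityLatticeLangevinBakryEmeryHessian
import HarnessLib

/-!
# Route `ColdStartUniversality` (fixed-cut-off package, Bakry–Émery side, GRADIENT half): the POINTWISE GRADIENT BOUND
# `Γ(P_t f)(x) ≤ e^(−2(1−12|β'|)t) · P_t(Γf)(x)` for the SU(2) SZZ semigroup, uniformly in the volume

Helper file (seat `ym-line-csu-p1`, g29; `--supports stmt-QuantumFields-24809`).  Third leg of the Bakry–Émery theorem at a fixed cut-off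
(after the volume-uniform Poincaré inequality `wilson_generatorPoincare_uniform`, g25, and log-Sobolev inequality
`wilson_generatorLogSobolev_uniform`, g26): the WEAK GRADIENT COMMUTATION for the lattice Langevin dynamics of Shen–Zhu–Zhu on `(ℤ/L)³`.
With `coords`, the noise covariance `A`, the coordinate carré du champ `Γ^A(φ)(x) = Σ_(ij) ∂_iφ ∂_jφ A_(ij)(x)` (`= 2Γ(φ)`) and any
realising Markov kernel family `κ` (`κ_t(x,·) = law of U_t`, `U_0 = x`):
* ★★★ `wilson_carre_transition_le_of_hessBound` — under the frame Hessian bound `K₀` of the plaquette function, for every `C⁵` `f` and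
  `t ≥ 0` there is a `C³` compactly supported `g` with `κ_t(f∘coords) = g∘coords` and, at EVERY configuration `x`,
  `e^((2−K₀)t) · Γ^A(g)(x) ≤ κ_t(Γ^A f)(x)`  (from the integrated form `integral_mul_carre_transition_le_of_hessBound` by letting the test
  function concentrate: a smooth bump in the flat coordinate space, positivity of `μ_(β')` on open sets);
* ★★ `wilson_carre_transition_le_of_hessBound_of_rep` — the same bound for ANY `C¹` representative of `κ_t(f∘coords)`;
* ★★★ `wilson_carre_transition_le_uniform` — `|β'| < 1/12` ⇒ the same with rate `2(1 − 12|β'|)` (`K₀ = 24|β'|`, `wilson_hessBound`),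
  for EVERY torus size `L`: `Γ(P_t f) ≤ e^(−2ρt) P_t Γ(f)`, `ρ = 1 − 12|β'|` (Bakry–Émery 1985; BGL Thm 3.2.3/3.3.18; SZZ Thm 4.2 / Cor. 4.4 use
  the same curvature `K_S = N/2 − 8(d−1)N|β|`);
* ★★ `wilson_lipschitz_contraction_uniform` — `sup_x Γ^A(κ_t F)(x) ≤ e^(−2(1−12|β'|)t) · sup Γ^A(F)`: the Lipschitz seminorm of
  `x ↦ E f(U_t^x)` decays exponentially at a volume-independent rate, with NO burn-in and NO entropy/variance budget.
THEOREMS ONLY, no definition, no sorry.  HONEST FRAMING: fixed cut-off; "uniform" = in `L` at fixed `|β'| < 1/12` — the route's scaling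
`β'_K = (γε_K)⁻¹/2 → ∞` leaves this window, so this does NOT bear on K_A1 as filed; nothing K-uniform; no crux, rung or summit statement
is proved; the Yang–Mills mass gap is NOT proved.
-/

set_option autoImplicit false

noncomputable section

namespace Summit.QuantumFields.YangMills.Theorems.ColdStartUniversality

open MeasureTheory ProbabilityTheory Matrix Complex Finset Filter Set Metric
open scoped ComplexConjugate BigOperators Matrix NNReal ENNReal Topology
open Literature.Probability.Process Literature.MathematicalPhysics.QuantumFieldTheory
open Literature.MathematicalPhysics.QuantumLattice (fundamentalRep fundamentalLatticeRep continuous_fundamentalRep fundamentalRep_apply)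

variable {L : ℕ} [NeZero L]

/-- ★★★ **Pointwise gradient bound (Bakry–Émery commutation) for the SZZ semigroup at a fixed cut-off.**  Under the frame Hessian bound
`K₀` of the plaquette function: for every `C⁵` function `f` of the real link coordinates and `t ≥ 0` there is a `C³` compactly supported
`g` with `κ_t(f∘coords) = g∘coords` on `SU(2)^E` and `e^((2−K₀)t)·Γ^A(g)(x) ≤ κ_t(Γ^A f)(x)` at every configuration `x`.
[cite: BakryGentilLedoux2014, Thm 3.2.3 and Thm 3.3.18; ShenZhuZhu2022 §4 Thm 4.2 / (4.7)–(4.8)] -/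
theorem wilson_carre_transition_le_of_hessBound (L : ℕ) [NeZero L] (β' K₀ : ℝ)
    (hHess : (∀ (V : (GaugeConfig 3 L (Matrix.specialUnitaryGroup (Fin 2) ℂ))) (Λ : (Edge 3 L × Fin (fundamentalLatticeRep 2).N × Fin (fundamentalLatticeRep 2).N × Bool → ℝ) →L[ℝ] ℝ),
      ∑ n : Edge 3 L × NoiseIdx (fundamentalLatticeRep 2).N, ∑ m : Edge 3 L × NoiseIdx (fundamentalLatticeRep 2).N,
        Λ ((fun q : Edge 3 L × Fin (fundamentalLatticeRep 2).N × Fin (fundamentalLatticeRep 2).N × Bool => if n.1 = q.1 then (fun z : ℂ => if q.2.2.2 then z.im else z.re) (((Real.sqrt 2 : ℂ) • ((fundamentalLatticeRep 2).lieProj (noiseDir n.2) * (fun (ee : Edge 3 L) => Matrix.of fun (i j : Fin (fundamentalLatticeRep 2).N) => (((fun (V : GaugeConfig 3 L (Matrix.specialUnitaryGroup (Fin 2) ℂ)) (q : Edge 3 L × Fin (fundamentalLatticeRep 2).N × Fin (fundamentalLatticeRep 2).N × Bool) => (fun z : ℂ => if q.2.2.2 then z.im else z.re) ((fundamentalRep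 (Fin 2) (V q.1) : Matrix (Fin 2) (Fin 2) ℂ) q.2.1 q.2.2.1)) V (ee, i, j, false) : ℝ) : ℂ) + (((fun (V : GaugeConfig 3 L (Matrix.specialUnitaryGroup (Fin 2) ℂ)) (q : Edge 3 L × Fin (fundamentalLatticeRep 2).N × Fin (fundamentalLatticeRep 2).N × Bool) => (fun z : ℂ => if q.2.2.2 then z.im else z.re) ((fundamentalRep (Fin 2) (V q.1) : Matrix (Fin 2) (Fin 2) ℂ) q.2.1 q.2.2.1)) V (ee, i, j, true) : ℝ) : ℂ) * Complex.I) q.1)) q.2.1 q.2.2.1) else 0)) * Λ ((fun q : Edge 3 L × Fin (fundamentalLatticeRep 2).N × Fin (fundamentalLatticeRep 2).N × Bool => if m.1 = q.1 then (fun z : ℂ => if q.2.2.2 then z.im else z.re) (((Real.sqrt 2 : ℂ) • ((fundamentalLatticeRep 2).lieProj (noiseDir m.2) * (fun (ee : Edge 3 L) => Matrix.of fun (i j : Fin (fundamentalLatticeRep 2).N) => (((fun (V : GaugeConfig 3 L (Matrix.specialUnitaryGroup (Fin 2) ℂ)) (q : Edge 3 L × Fin (fundamentalLatticeRep 2).N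 × Fin (fundamentalLatticeRep 2).N × Bool) => (fun z : ℂ => if q.2.2.2 then z.im else z.re) ((fundamentalRep (Fin 2) (V q.1) : Matrix (Fin 2) (Fin 2) ℂ) q.2.1 q.2.2.1)) V (ee, i, j, false) : ℝ) : ℂ) + (((fun (V : GaugeConfig 3 L (Matrix.specialUnitaryGroup (Fin 2) ℂ)) (q : Edge 3 L × Fin (fundamentalLatticeRep 2).N × Fin (fundamentalLatticeRep 2).N × Bool) => (fun z : ℂ => if q.2.2.2 then z.im else z.re) ((fundamentalRep (Fin 2) (V q.1) : Matrix (Fin 2) (Fin 2) ℂ) q.2.1 q.2.2.1)) V (ee, i, j, true) : ℝ) : ℂ) * Complex.I) q.1)) q.2.1 q.2.2.1) else 0)) *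
          fderiv ℝ (fun z : (Edge 3 L × Fin (fundamentalLatticeRep 2).N × Fin (fundamentalLatticeRep 2).N × Bool → ℝ) => fderiv ℝ (fun y : (Edge 3 L × Fin (fundamentalLatticeRep 2).N × Fin (fundamentalLatticeRep 2).N × Bool → ℝ) => β' * ∑ p : Plaquette 3 L, (rootedLoop (fun (ee : Edge 3 L) (i j : Fin (fundamentalLatticeRep 2).N) => ((y (ee, i, j, false) : ℝ) : ℂ) + ((y (ee, i, j, true) : ℝ) : ℂ) * Complex.I) (p.1, p.2.1.1) p.2.1.2 false).trace.re) z (fun q : Edge 3 L × Fin (fundamentalLatticeRep 2).N × Fin (fundamentalLatticeRep 2).N × Bool => if m.1 = q.1 then (fun z : ℂ => if q.2.2.2 then z.im else z.re) (((Real.sqrt 2 : ℂ) • ((fundamentalLatticeRep 2).lieProj (noiseDir m.2) * (fun (ee : Edge 3 L) => Matrix.of fun (i j : Fin (fundamentalLatticeRep 2).N) => ((z (ee, i, j, false) : ℝ) : ℂ) + ((z (ee, i, j, true) : ℝ) : ℂ) * Complex.I) q.1)) q.2.1 q.2.2.1) else 0)) ((fun (V : GaugeConfig 3 L (Matrix.specialUnitaryGroup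 (Fin 2) ℂ)) (q : Edge 3 L × Fin (fundamentalLatticeRep 2).N × Fin (fundamentalLatticeRep 2).N × Bool) => (fun z : ℂ => if q.2.2.2 then z.im else z.re) ((fundamentalRep (Fin 2) (V q.1) : Matrix (Fin 2) (Fin 2) ℂ) q.2.1 q.2.2.1)) V) (fun q : Edge 3 L × Fin (fundamentalLatticeRep 2).N × Fin (fundamentalLatticeRep 2).N × Bool => if n.1 = q.1 then (fun z : ℂ => if q.2.2.2 then z.im else z.re) (((Real.sqrt 2 : ℂ) • ((fundamentalLatticeRep 2).lieProj (noiseDir n.2) * (fun (ee : Edge 3 L) => Matrix.of fun (i j : Fin (fundamentalLatticeRep 2).N) => (((fun (V : GaugeConfig 3 L (Matrix.specialUnitaryGroup (Fin 2) ℂ)) (q : Edge 3 L × Fin (fundamentalLatticeRep 2).N × Fin (fundamentalLatticeRep 2).N × Bool) => (fun z : ℂ => if q.2.2.2 then z.im else z.re) ((fundamentalRep (Fin 2) (V q.1) : Matrix (Fin 2) (Fin 2) ℂ) q.2.1 q.2.2.1)) V (ee, i, j, false) : ℝ) : ℂ) + (((fun (V : GaugeConfig 3 L (Matrix.specialUnitaryGroup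 (Fin 2) ℂ)) (q : Edge 3 L × Fin (fundamentalLatticeRep 2).N × Fin (fundamentalLatticeRep 2).N × Bool) => (fun z : ℂ => if q.2.2.2 then z.im else z.re) ((fundamentalRep (Fin 2) (V q.1) : Matrix (Fin 2) (Fin 2) ℂ) q.2.1 q.2.2.1)) V (ee, i, j, true) : ℝ) : ℂ) * Complex.I) q.1)) q.2.1 q.2.2.1) else 0)
        ≤ K₀ * ∑ n : Edge 3 L × NoiseIdx (fundamentalLatticeRep 2).N, (Λ (fun q : Edge 3 L × Fin (fundamentalLatticeRep 2).N × Fin (fundamentalLatticeRep 2).N × Bool => if n.1 = q.1 then (fun z : ℂ => if q.2.2.2 then z.im else z.re) (((Real.sqrt 2 : ℂ) • ((fundamentalLatticeRep 2).lieProj (noiseDir n.2) * (fun (ee : Edge 3 L) => Matrix.of fun (i j : Fin (fundamentalLatticeRep 2).N) => (((fun (V : GaugeConfig 3 L (Matrix.specialUnitaryGroup (Fin 2) ℂ)) (q : Edge 3 L × Fin (fundamentalLatticeRep 2).N × Fin (fundamentalLatticeRep 2).N × Bool) => (fun z : ℂ => if q.2.2.2 then z.im else z.re) ((fundamentalRep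 (Fin 2) (V q.1) : Matrix (Fin 2) (Fin 2) ℂ) q.2.1 q.2.2.1)) V (ee, i, j, false) : ℝ) : ℂ) + (((fun (V : GaugeConfig 3 L (Matrix.specialUnitaryGroup (Fin 2) ℂ)) (q : Edge 3 L × Fin (fundamentalLatticeRep 2).N × Fin (fundamentalLatticeRep 2).N × Bool) => (fun z : ℂ => if q.2.2.2 then z.im else z.re) ((fundamentalRep (Fin 2) (V q.1) : Matrix (Fin 2) (Fin 2) ℂ) q.2.1 q.2.2.1)) V (ee, i, j, true) : ℝ) : ℂ) * Complex.I) q.1)) q.2.1 q.2.2.1) else 0)) ^ 2))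
    (κ : ℝ≥0 → Kernel (GaugeConfig 3 L (Matrix.specialUnitaryGroup (Fin 2) ℂ))
      (GaugeConfig 3 L (Matrix.specialUnitaryGroup (Fin 2) ℂ))) [∀ t, IsMarkovKernel (κ t)]
    (hreal : ∀ (t : ℝ≥0) (x : GaugeConfig 3 L (Matrix.specialUnitaryGroup (Fin 2) ℂ))
        (Ω : Type) [MeasurableSpace Ω] (P : Measure Ω) [IsProbabilityMeasure P]
        (W : ℝ≥0 → Ω → (Edge 3 L × NoiseIdx 2 → ℝ)) (hW : IsFlatBrownian W P)
        (U : ℝ≥0 → Ω → GaugeConfig 3 L (Matrix.specialUnitaryGroup (Fin 2) ℂ)),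
        (∀ ω, U 0 ω = x) →
        (latticeLangevinDynamics (fundamentalLatticeRep 2) β').IsSolution (fundamentalRep (Fin 2))
          hW.natFiltration P W U →
        κ t x = P.map (U t))
    {f : (Edge 3 L × Fin 2 × Fin 2 × Bool → ℝ) → ℝ} (hf : ContDiff ℝ 5 f) (t : ℝ≥0) :
    let coords : GaugeConfig 3 L (Matrix.specialUnitaryGroup (Fin 2) ℂ) → (Edge 3 L × Fin 2 × Fin 2 × Bool → ℝ) :=
      fun V q => (fun z : ℂ => if q.2.2.2 then z.im else z.re)
        ((fundamentalRep (Fin 2) (V q.1) : Matrix (Fin 2) (Fin 2) ℂ) q.2.1 q.2.2.1)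
    let A : GaugeConfig 3 L (Matrix.specialUnitaryGroup (Fin 2) ℂ) → (Edge 3 L × Fin 2 × Fin 2 × Bool) →
        (Edge 3 L × Fin 2 × Fin 2 × Bool) → ℝ := fun V i j =>
      ∑ n : Edge 3 L × NoiseIdx 2,
        (if n.1 = i.1 then (fun z : ℂ => if i.2.2.2 then z.im else z.re)
          ((latticeLangevinDynamics (fundamentalLatticeRep 2) β').noise
            (matrixConfig (fundamentalRep (Fin 2)) V) i.1 n.2 i.2.1 i.2.2.1) else 0) *
        (if n.1 = j.1 then (fun z : ℂ => if j.2.2.2 then z.im else z.re)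
          ((latticeLangevinDynamics (fundamentalLatticeRep 2) β').noise
            (matrixConfig (fundamentalRep (Fin 2)) V) j.1 n.2 j.2.1 j.2.2.1) else 0)
    ∃ g : (Edge 3 L × Fin 2 × Fin 2 × Bool → ℝ) → ℝ, ContDiff ℝ 3 g ∧ HasCompactSupport g ∧ (∀ x, ∫ y, f (coords y) ∂(κ t x) = g (coords x)) ∧
      ∀ x, Real.exp ((2 - K₀) * (t : ℝ)) * (∑ i : Edge 3 L × Fin 2 × Fin 2 × Bool, ∑ j : Edge 3 L × Fin 2 × Fin 2 × Bool, fderiv ℝ g (coords x) (Pi.single i 1) * fderiv ℝ g (coords x) (Pi.single j 1) * A x i j) ≤ ∫ y, (∑ i : Edge 3 L × Fin 2 × Fin 2 × Bool, ∑ j : Edge 3 L × Fin 2 × Fin 2 × Bool, fderiv ℝ f (coords y) (Pi.single i 1) * fderiv ℝ f (coords y) (Pi.single j 1) * A y i j) ∂(κ t x) := by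
  intro coords A
  classical
  haveI := secondCountableTopology_su2
  haveI := borelSpace_config L
  set μ : Measure (GaugeConfig 3 L (Matrix.specialUnitaryGroup (Fin 2) ℂ)) := (wilsonMeasure (d := 3) (L := L) (fundamentalRep (Fin 2)) β') with hμ
  haveI : IsProbabilityMeasure μ :=
    isProbabilityMeasure_wilsonMeasure (d := 3) (L := L) (fundamentalRep (Fin 2)) (continuous_fundamentalRep (Fin 2)) β'
  have hco : Continuous coords := continuous_coords (L := L)
  have hInt : ∀ {Φ : (GaugeConfig 3 L (Matrix.specialUnitaryGroup (Fin 2) ℂ)) → ℝ}, Continuous Φ → Integrable Φ μ := fun hΦ => integrable_of_continuous_of_compactSpace hΦ μ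
  -- §1 compactly supported cut-off of `f`, exact near the (bounded) range of the coordinates
  obtain ⟨f₁, hf₁, hf₁c, hf₁eq⟩ := exists_contDiff_hasCompactSupport_eqOn (n := 5) hf 1
  have hnear : ∀ x : (GaugeConfig 3 L (Matrix.specialUnitaryGroup (Fin 2) ℂ)), f₁ =ᶠ[𝓝 (coords x)] f := fun x => hf₁eq _ (norm_coords_le_one x)
  have hval : ∀ x : (GaugeConfig 3 L (Matrix.specialUnitaryGroup (Fin 2) ℂ)), f₁ (coords x) = f (coords x) := fun x => (hnear x).self_of_nhds
  have hfd : ∀ x : (GaugeConfig 3 L (Matrix.specialUnitaryGroup (Fin 2) ℂ)), fderiv ℝ f₁ (coords x) = fderiv ℝ f (coords x) := fun x => (hnear x).fderiv_eq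
  have hΓeq : ∀ x : (GaugeConfig 3 L (Matrix.specialUnitaryGroup (Fin 2) ℂ)), (∑ i : Edge 3 L × Fin 2 × Fin 2 × Bool, ∑ j : Edge 3 L × Fin 2 × Fin 2 × Bool, fderiv ℝ f₁ (coords x) (Pi.single i 1) * fderiv ℝ f₁ (coords x) (Pi.single j 1) * A x i j) = (∑ i : Edge 3 L × Fin 2 × Fin 2 × Bool, ∑ j : Edge 3 L × Fin 2 × Fin 2 × Bool, fderiv ℝ f (coords x) (Pi.single i 1) * fderiv ℝ f (coords x) (Pi.single j 1) * A x i j) := fun x => by rw [hfd x]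
  have hf₁3 : ContDiff ℝ 3 f₁ := hf₁.of_le (by norm_num)
  -- §2 the representative of `κ_t F`
  obtain ⟨g, hg, hgc, hgrep⟩ := transitionKernel_preserves_dynkinClass L β' κ hreal t hf₁3
  have hgrep₁ : ∀ x : (GaugeConfig 3 L (Matrix.specialUnitaryGroup (Fin 2) ℂ)), ∫ y, f₁ (coords y) ∂(κ t x) = g (coords x) := fun x => hgrep x
  have hgrep' : ∀ x : (GaugeConfig 3 L (Matrix.specialUnitaryGroup (Fin 2) ℂ)), ∫ y, f (coords y) ∂(κ t x) = g (coords x) := fun x =>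
    (integral_congr_ae (ae_of_all _ fun y => (hval y).symm)).trans (hgrep₁ x)
  refine ⟨g, hg, hgc, hgrep', fun x₀ => ?_⟩
  -- §3 the integrated bound for every admissible test function
  have hflow : ∀ (h : (Edge 3 L × Fin 2 × Fin 2 × Bool → ℝ) → ℝ), ContDiff ℝ 5 h → HasCompactSupport h → (∀ x : (GaugeConfig 3 L (Matrix.specialUnitaryGroup (Fin 2) ℂ)), 0 ≤ h (coords x)) →
      Real.exp ((2 - K₀) * (t : ℝ)) * ∫ x, h (coords x) * (∑ i : Edge 3 L × Fin 2 × Fin 2 × Bool, ∑ j : Edge 3 L × Fin 2 × Fin 2 × Bool, fderiv ℝ g (coords x) (Pi.single i 1) * fderiv ℝ g (coords x) (Pi.single j 1) * A x i j) ∂μ ≤ ∫ x, h (coords x) * (∫ y, (∑ i : Edge 3 L × Fin 2 × Fin 2 × Bool, ∑ j : Edge 3 L × Fin 2 × Fin 2 × Bool, fderiv ℝ f₁ (coords y) (Pi.single i 1) * fderiv ℝ f₁ (coords y) (Pi.single j 1) * A y i j) ∂(κ t x)) ∂μ :=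
    fun h hh hhc hh0 => integral_mul_carre_transition_le_of_hessBound L β' K₀ hHess κ hreal hf₁ hf₁c hh hhc t hg hgc hh0 hgrep₁
  -- §4 both sides are continuous functions of the coordinates
  obtain ⟨s, c, hs, -, -, -, -⟩ := exists_noiseFrame L
  set s2 : (Edge 3 L × NoiseIdx (fundamentalLatticeRep 2).N) → ((Edge 3 L × Fin 2 × Fin 2 × Bool → ℝ) →L[ℝ] (Edge 3 L × Fin 2 × Fin 2 × Bool → ℝ)) := s with hs2def
  have hs2 : ∀ (n : Edge 3 L × NoiseIdx (fundamentalLatticeRep 2).N) (y : (Edge 3 L × Fin 2 × Fin 2 × Bool → ℝ)), s2 n y = (fun q : Edge 3 L × Fin (fundamentalLatticeRep 2).N × Fin (fundamentalLatticeRep 2).N × Bool => if n.1 = q.1 then (fun z : ℂ => if q.2.2.2 then z.im else z.re) (((Real.sqrt 2 : ℂ) • ((fundamentalLatticeRep 2).lieProj (noiseDir n.2) * (fun (ee : Edge 3 L) => Matrix.of fun (i j : Fin (fundamentalLatticeRep 2).N) => ((y (ee, i, j, false) : ℝ) : ℂ) + ((y (ee, i, j, true) : ℝ) : ℂ) * Complex.I)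 q.1)) q.2.1 q.2.2.1) else 0) := fun n y => hs n y
  have hGam : ∀ {φ : (Edge 3 L × Fin 2 × Fin 2 × Bool → ℝ) → ℝ} (x : (GaugeConfig 3 L (Matrix.specialUnitaryGroup (Fin 2) ℂ))), (∑ i : Edge 3 L × Fin 2 × Fin 2 × Bool, ∑ j : Edge 3 L × Fin 2 × Fin 2 × Bool, fderiv ℝ φ (coords x) (Pi.single i 1) * fderiv ℝ φ (coords x) (Pi.single j 1) * A x i j) = ∑ n, (fderiv ℝ φ (coords x) (s2 n (coords x))) ^ 2 := by
    intro φ x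
    have h : (∑ i : Edge 3 L × Fin 2 × Fin 2 × Bool, ∑ j : Edge 3 L × Fin 2 × Fin 2 × Bool, fderiv ℝ φ (coords x) (Pi.single i 1) * fderiv ℝ φ (coords x) (Pi.single j 1) * A x i j) =
        ∑ n : Edge 3 L × NoiseIdx (fundamentalLatticeRep 2).N, fderiv ℝ φ (coords x) (fun q : Edge 3 L × Fin (fundamentalLatticeRep 2).N × Fin (fundamentalLatticeRep 2).N × Bool => if n.1 = q.1 then (fun z : ℂ => if q.2.2.2 then z.im else z.re) (((Real.sqrt 2 : ℂ) • ((fundamentalLatticeRep 2).lieProj (noiseDir n.2) * (fun (ee : Edge 3 L) => Matrix.of fun (i j : Fin (fundamentalLatticeRep 2).N) => ((coords x (ee, i, j, false) : ℝ) : ℂ) + ((coords x (ee, i, j, true) : ℝ) : ℂ) * Complex.I) q.1)) q.2.1 q.2.2.1) else 0) * fderiv ℝ φ (coords x) (fun q : Edge 3 L × Fin (fundamentalLatticeRep 2).N × Fin (fundamentalLatticeRep 2).N × Bool => if n.1 = q.1 then (fun z : ℂ => if q.2.2.2 then z.im else z.re) (((Real.sqrt 2 : ℂ) • ((fundamentalLatticeRep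 2).lieProj (noiseDir n.2) * (fun (ee : Edge 3 L) => Matrix.of fun (i j : Fin (fundamentalLatticeRep 2).N) => ((coords x (ee, i, j, false) : ℝ) : ℂ) + ((coords x (ee, i, j, true) : ℝ) : ℂ) * Complex.I) q.1)) q.2.1 q.2.2.1) else 0) :=
      carre_eq_sum_frameDeriv_mul L β' φ φ x
    rw [h]
    refine Finset.sum_congr rfl fun n _ => ?_
    rw [← hs2 n (coords x), sq]
  set Gf : (Edge 3 L × Fin 2 × Fin 2 × Bool → ℝ) → ℝ := fun y => ∑ n, (fderiv ℝ f₁ y (s2 n y)) ^ 2 with hGf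
  set Gg : (Edge 3 L × Fin 2 × Fin 2 × Bool → ℝ) → ℝ := fun y => ∑ n, (fderiv ℝ g y (s2 n y)) ^ 2 with hGg
  have hGfC : ContDiff ℝ 3 Gf := ContDiff.sum fun n _ => ((contDiff_frameDeriv (k := 4) hf₁ (s2 n)).pow 2).of_le (by norm_num)
  have hGgC : Continuous Gg := continuous_finsetSum _ fun n _ => ((contDiff_frameDeriv (k := 2) hg (s2 n)).continuous).pow 2
  have hGfc : HasCompactSupport Gf := by
    refine (hf₁c.fderiv (𝕜 := ℝ)).mono fun y hy => ?_
    rw [Function.mem_support] at hy ⊢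
    intro h0
    apply hy
    simp only [hGf, h0, _root_.zero_apply]
    simp
  obtain ⟨gr, hgr, -, hgrrep⟩ := transitionKernel_preserves_dynkinClass L β' κ hreal t hGfC
  have hR : ∀ x : (GaugeConfig 3 L (Matrix.specialUnitaryGroup (Fin 2) ℂ)), ∫ y, (∑ i : Edge 3 L × Fin 2 × Fin 2 × Bool, ∑ j : Edge 3 L × Fin 2 × Fin 2 × Bool, fderiv ℝ f₁ (coords y) (Pi.single i 1) * fderiv ℝ f₁ (coords y) (Pi.single j 1) * A y i j) ∂(κ t x) = gr (coords x) := by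
    intro x
    have h1 : ∫ y, Gf (coords y) ∂(κ t x) = gr (coords x) := hgrrep x
    rw [← h1]
    exact integral_congr_ae (ae_of_all _ fun y => hGam y)
  set Φ : (Edge 3 L × Fin 2 × Fin 2 × Bool → ℝ) → ℝ := fun y => Real.exp ((2 - K₀) * (t : ℝ)) * Gg y - gr y with hΦ
  have hΦc : Continuous Φ := (continuous_const.mul hGgC).sub hgr.continuous
  have hΦx : ∀ x : (GaugeConfig 3 L (Matrix.specialUnitaryGroup (Fin 2) ℂ)), Φ (coords x) = Real.exp ((2 - K₀) * (t : ℝ)) * (∑ i : Edge 3 L × Fin 2 × Fin 2 × Bool, ∑ j : Edge 3 L × Fin 2 × Fin 2 × Bool, fderiv ℝ g (coords x) (Pi.single i 1) * fderiv ℝ g (coords x) (Pi.single j 1) * A x i j) - ∫ y, (∑ i : Edge 3 L × Fin 2 × Fin 2 × Bool, ∑ j : Edge 3 L × Fin 2 × Fin 2 × Bool, fderiv ℝ f₁ (coords y) (Pi.single i 1) * fderiv ℝ f₁ (coords y) (Pi.single j 1) * A y i j) ∂(κ t x) := by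
    intro x; rw [hR x, hGam x]
  -- §5 suppose the pointwise bound fails at `x₀`; a bump around `coords x₀` then contradicts §3
  by_contra hlt
  rw [not_le] at hlt
  have hΦ0 : 0 < Φ (coords x₀) := by
    rw [hΦx x₀]
    have e : ∫ y, (∑ i : Edge 3 L × Fin 2 × Fin 2 × Bool, ∑ j : Edge 3 L × Fin 2 × Fin 2 × Bool, fderiv ℝ f₁ (coords y) (Pi.single i 1) * fderiv ℝ f₁ (coords y) (Pi.single j 1) * A y i j) ∂(κ t x₀) = ∫ y, (∑ i : Edge 3 L × Fin 2 × Fin 2 × Bool, ∑ j : Edge 3 L × Fin 2 × Fin 2 × Bool, fderiv ℝ f (coords y) (Pi.single i 1) * fderiv ℝ f (coords y) (Pi.single j 1) * A y i j) ∂(κ t x₀) := integral_congr_ae (ae_of_all _ fun y => hΓeq y)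
    rw [e]; linarith
  have hO : IsOpen {y : (Edge 3 L × Fin 2 × Fin 2 × Bool → ℝ) | 0 < Φ y} := isOpen_lt continuous_const hΦc
  obtain ⟨ε, hε, hball⟩ := Metric.isOpen_iff.1 hO (coords x₀) hΦ0
  let χ : ContDiffBump (coords x₀) := ⟨ε / 4, ε / 2, by positivity, by linarith⟩
  have hχ5 : ContDiff ℝ 5 (χ : (Edge 3 L × Fin 2 × Fin 2 × Bool → ℝ) → ℝ) := χ.contDiff
  have hχ0 : ∀ x : (GaugeConfig 3 L (Matrix.specialUnitaryGroup (Fin 2) ℂ)), 0 ≤ (χ : (Edge 3 L × Fin 2 × Fin 2 × Bool → ℝ) → ℝ) (coords x) := fun x => χ.nonneg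
  have hprod0 : ∀ x : (GaugeConfig 3 L (Matrix.specialUnitaryGroup (Fin 2) ℂ)), 0 ≤ (χ : (Edge 3 L × Fin 2 × Fin 2 × Bool → ℝ) → ℝ) (coords x) * Φ (coords x) := by
    intro x
    by_cases hz : (χ : (Edge 3 L × Fin 2 × Fin 2 × Bool → ℝ) → ℝ) (coords x) = 0
    · rw [hz, zero_mul]
    · have hmem : coords x ∈ Function.support (χ : (Edge 3 L × Fin 2 × Fin 2 × Bool → ℝ) → ℝ) := hz
      rw [χ.support_eq] at hmem
      have hin : coords x ∈ ball (coords x₀) ε := ball_subset_ball (by show χ.rOut ≤ ε; simp only [χ]; linarith) hmem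
      exact mul_nonneg χ.nonneg (le_of_lt (hball hin))
  have hpos0 : 0 < (χ : (Edge 3 L × Fin 2 × Fin 2 × Bool → ℝ) → ℝ) (coords x₀) * Φ (coords x₀) := by
    rw [χ.one_of_mem_closedBall (mem_closedBall_self (by show (0 : ℝ) ≤ χ.rIn; simp only [χ]; positivity)), one_mul]
    exact hΦ0
  have cP : Continuous fun x : (GaugeConfig 3 L (Matrix.specialUnitaryGroup (Fin 2) ℂ)) => (χ : (Edge 3 L × Fin 2 × Fin 2 × Bool → ℝ) → ℝ) (coords x) * Φ (coords x) :=
    (χ.continuous.comp hco).mul (hΦc.comp hco)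
  -- positivity of `μ_(β')` on nonempty open sets (product Haar is open-positive, `μ_(β') = π.tilted(−β' S_W)`)
  set π : Measure (GaugeConfig 3 L (Matrix.specialUnitaryGroup (Fin 2) ℂ)) := Measure.pi fun _ : Edge 3 L => haarProbability (Matrix.specialUnitaryGroup (Fin 2) ℂ) with hπ
  haveI : π.IsOpenPosMeasure := by
    rw [hπ]
    haveI : ∀ _e : Edge 3 L, (haarProbability (Matrix.specialUnitaryGroup (Fin 2) ℂ)).IsOpenPosMeasure := fun _ => by
      unfold haarProbability; infer_instance
    infer_instance
  have hπμ : π ≪ μ := by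
    rw [hμ, Literature.MathematicalPhysics.QuantumLattice.wilsonMeasure_eq_tilted_pi (fundamentalRep (Fin 2))
      (continuous_fundamentalRep (n := Fin 2)) β', ← hπ]
    refine absolutelyContinuous_tilted ?_
    obtain ⟨B, hB⟩ := exists_abs_wilsonAction_le (d := 3) (L := L) (fundamentalRep (Fin 2)) (continuous_fundamentalRep (Fin 2))
    refine Integrable.of_bound (((measurable_wilsonAction (d := 3) (L := L) (fundamentalRep (Fin 2)) (continuous_fundamentalRep (Fin 2))).const_mul _).exp).aestronglyMeasurable
      (Real.exp (|β'| * B)) (ae_of_all _ fun U => ?_)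
    rw [Real.norm_eq_abs, Real.abs_exp, Real.exp_le_exp]
    have h1 : |β' * wilsonAction (fundamentalRep (Fin 2)) U| ≤ |β'| * B := by
      rw [abs_mul]; exact mul_le_mul_of_nonneg_left (hB U) (abs_nonneg _)
    have h2 := (abs_le.1 h1).1
    linarith
  have hIpos : 0 < ∫ x, (χ : (Edge 3 L × Fin 2 × Fin 2 × Bool → ℝ) → ℝ) (coords x) * Φ (coords x) ∂μ := by
    rw [integral_pos_iff_support_of_nonneg (fun x => hprod0 x) (hInt cP)]
    have hU : IsOpen {x : (GaugeConfig 3 L (Matrix.specialUnitaryGroup (Fin 2) ℂ)) | 0 < (χ : (Edge 3 L × Fin 2 × Fin 2 × Bool → ℝ) → ℝ) (coords x) * Φ (coords x)} := isOpen_lt continuous_const cP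
    have hUπ : 0 < π {x : (GaugeConfig 3 L (Matrix.specialUnitaryGroup (Fin 2) ℂ)) | 0 < (χ : (Edge 3 L × Fin 2 × Fin 2 × Bool → ℝ) → ℝ) (coords x) * Φ (coords x)} := hU.measure_pos π ⟨x₀, hpos0⟩
    have hUμ : 0 < μ {x : (GaugeConfig 3 L (Matrix.specialUnitaryGroup (Fin 2) ℂ)) | 0 < (χ : (Edge 3 L × Fin 2 × Fin 2 × Bool → ℝ) → ℝ) (coords x) * Φ (coords x)} :=
      pos_iff_ne_zero.2 fun h0 => hUπ.ne' (hπμ h0)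
    exact hUμ.trans_le (measure_mono fun x hx => ne_of_gt hx)
  -- but the integrated bound says this integral is `≤ 0`
  have hle : ∫ x, (χ : (Edge 3 L × Fin 2 × Fin 2 × Bool → ℝ) → ℝ) (coords x) * Φ (coords x) ∂μ ≤ 0 := by
    have h1 := hflow χ hχ5 χ.hasCompactSupport hχ0
    have cχ : Continuous fun x : (GaugeConfig 3 L (Matrix.specialUnitaryGroup (Fin 2) ℂ)) => (χ : (Edge 3 L × Fin 2 × Fin 2 × Bool → ℝ) → ℝ) (coords x) := χ.continuous.comp hco
    have cΓg : Continuous fun x : (GaugeConfig 3 L (Matrix.specialUnitaryGroup (Fin 2) ℂ)) => (∑ i : Edge 3 L × Fin 2 × Fin 2 × Bool, ∑ j : Edge 3 L × Fin 2 × Fin 2 × Bool, fderiv ℝ g (coords x) (Pi.single i 1) * fderiv ℝ g (coords x) (Pi.single j 1) * A x i j) := by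
      rw [show (fun x : (GaugeConfig 3 L (Matrix.specialUnitaryGroup (Fin 2) ℂ)) => (∑ i : Edge 3 L × Fin 2 × Fin 2 × Bool, ∑ j : Edge 3 L × Fin 2 × Fin 2 × Bool, fderiv ℝ g (coords x) (Pi.single i 1) * fderiv ℝ g (coords x) (Pi.single j 1) * A x i j)) = fun x => Gg (coords x) from funext fun x => hGam x]
      exact hGgC.comp hco
    have cR : Continuous fun x : (GaugeConfig 3 L (Matrix.specialUnitaryGroup (Fin 2) ℂ)) => ∫ y, (∑ i : Edge 3 L × Fin 2 × Fin 2 × Bool, ∑ j : Edge 3 L × Fin 2 × Fin 2 × Bool, fderiv ℝ f₁ (coords y) (Pi.single i 1) * fderiv ℝ f₁ (coords y) (Pi.single j 1) * A y i j) ∂(κ t x) := by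
      rw [show (fun x : (GaugeConfig 3 L (Matrix.specialUnitaryGroup (Fin 2) ℂ)) => ∫ y, (∑ i : Edge 3 L × Fin 2 × Fin 2 × Bool, ∑ j : Edge 3 L × Fin 2 × Fin 2 × Bool, fderiv ℝ f₁ (coords y) (Pi.single i 1) * fderiv ℝ f₁ (coords y) (Pi.single j 1) * A y i j) ∂(κ t x)) = fun x => gr (coords x) from funext fun x => hR x]
      exact hgr.continuous.comp hco
    have i1 : Integrable (fun x => Real.exp ((2 - K₀) * (t : ℝ)) * ((χ : (Edge 3 L × Fin 2 × Fin 2 × Bool → ℝ) → ℝ) (coords x) * (∑ i : Edge 3 L × Fin 2 × Fin 2 × Bool, ∑ j : Edge 3 L × Fin 2 × Fin 2 × Bool, fderiv ℝ g (coords x) (Pi.single i 1) * fderiv ℝ g (coords x) (Pi.single j 1) * A x i j))) μ := (hInt (cχ.mul cΓg)).const_mul _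
    have i2 : Integrable (fun x => (χ : (Edge 3 L × Fin 2 × Fin 2 × Bool → ℝ) → ℝ) (coords x) * (∫ y, (∑ i : Edge 3 L × Fin 2 × Fin 2 × Bool, ∑ j : Edge 3 L × Fin 2 × Fin 2 × Bool, fderiv ℝ f₁ (coords y) (Pi.single i 1) * fderiv ℝ f₁ (coords y) (Pi.single j 1) * A y i j) ∂(κ t x))) μ := hInt (cχ.mul cR)
    have e : ∫ x, (χ : (Edge 3 L × Fin 2 × Fin 2 × Bool → ℝ) → ℝ) (coords x) * Φ (coords x) ∂μ =
        Real.exp ((2 - K₀) * (t : ℝ)) * ∫ x, (χ : (Edge 3 L × Fin 2 × Fin 2 × Bool → ℝ) → ℝ) (coords x) * (∑ i : Edge 3 L × Fin 2 × Fin 2 × Bool, ∑ j : Edge 3 L × Fin 2 × Fin 2 × Bool, fderiv ℝ g (coords x) (Pi.single i 1) * fderiv ℝ g (coords x) (Pi.single j 1) * A x i j) ∂μ -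
          ∫ x, (χ : (Edge 3 L × Fin 2 × Fin 2 × Bool → ℝ) → ℝ) (coords x) * (∫ y, (∑ i : Edge 3 L × Fin 2 × Fin 2 × Bool, ∑ j : Edge 3 L × Fin 2 × Fin 2 × Bool, fderiv ℝ f₁ (coords y) (Pi.single i 1) * fderiv ℝ f₁ (coords y) (Pi.single j 1) * A y i j) ∂(κ t x)) ∂μ := by
      rw [← integral_const_mul, ← integral_sub i1 i2]
      refine integral_congr_ae (ae_of_all _ fun x => ?_)
      show (χ : (Edge 3 L × Fin 2 × Fin 2 × Bool → ℝ) → ℝ) (coords x) * Φ (coords x) = _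
      rw [hΦx x]; ring
    rw [e]; linarith
  exact absurd hle (not_le.2 hIpos)

/-- ★★ **The pointwise gradient bound for ANY `C¹` representative** of `κ_t(f∘coords)`: the carré du champ on the group only sees the
restriction to the group (`frameDeriv_eq_of_comp_coords_eq`), so `e^((2−K₀)t)·Γ^A(g')(x) ≤ κ_t(Γ^A f)(x)` for every `C¹` `g'` with
`κ_t(f∘coords) = g'∘coords`. [cite: BakryGentilLedoux2014, Thm 3.2.3] -/
theorem wilson_carre_transition_le_of_hessBound_of_rep (L : ℕ) [NeZero L] (β' K₀ : ℝ)
    (hHess : (∀ (V : (GaugeConfig 3 L (Matrix.specialUnitaryGroup (Fin 2) ℂ))) (Λ : (Edge 3 L × Fin (fundamentalLatticeRep 2).N × Fin (fundamentalLatticeRep 2).N × Bool → ℝ) →L[ℝ] ℝ),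
      ∑ n : Edge 3 L × NoiseIdx (fundamentalLatticeRep 2).N, ∑ m : Edge 3 L × NoiseIdx (fundamentalLatticeRep 2).N,
        Λ ((fun q : Edge 3 L × Fin (fundamentalLatticeRep 2).N × Fin (fundamentalLatticeRep 2).N × Bool => if n.1 = q.1 then (fun z : ℂ => if q.2.2.2 then z.im else z.re) (((Real.sqrt 2 : ℂ) • ((fundamentalLatticeRep 2).lieProj (noiseDir n.2) * (fun (ee : Edge 3 L) => Matrix.of fun (i j : Fin (fundamentalLatticeRep 2).N) => (((fun (V : GaugeConfig 3 L (Matrix.specialUnitaryGroup (Fin 2) ℂ)) (q : Edge 3 L × Fin (fundamentalLatticeRep 2).N × Fin (fundamentalLatticeRep 2).N × Bool) => (fun z : ℂ => if q.2.2.2 then z.im else z.re) ((fundamentalRep (Fin 2) (V q.1) : Matrix (Fin 2) (Fin 2) ℂ) q.2.1 q.2.2.1)) V (ee, i, j, false) : ℝ) : ℂ) + (((fun (V : GaugeConfig 3 L (Matrix.specialUnitaryGroup (Fin 2) ℂ)) (q : Edge 3 L × Fin (fundamentalLatticeRep 2).N × Fin (fundamentalLatticeRep 2).N × Bool) => (fun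 z : ℂ => if q.2.2.2 then z.im else z.re) ((fundamentalRep (Fin 2) (V q.1) : Matrix (Fin 2) (Fin 2) ℂ) q.2.1 q.2.2.1)) V (ee, i, j, true) : ℝ) : ℂ) * Complex.I) q.1)) q.2.1 q.2.2.1) else 0)) * Λ ((fun q : Edge 3 L × Fin (fundamentalLatticeRep 2).N × Fin (fundamentalLatticeRep 2).N × Bool => if m.1 = q.1 then (fun z : ℂ => if q.2.2.2 then z.im else z.re) (((Real.sqrt 2 : ℂ) • ((fundamentalLatticeRep 2).lieProj (noiseDir m.2) * (fun (ee : Edge 3 L) => Matrix.of fun (i j : Fin (fundamentalLatticeRep 2).N) => (((fun (V : GaugeConfig 3 L (Matrix.specialUnitaryGroup (Fin 2) ℂ)) (q : Edge 3 L × Fin (fundamentalLatticeRep 2).N × Fin (fundamentalLatticeRep 2).N × Bool) => (fun z : ℂ => if q.2.2.2 then z.im else z.re) ((fundamentalRep (Fin 2) (V q.1) : Matrix (Fin 2) (Fin 2) ℂ) q.2.1 q.2.2.1)) V (ee, i, j, false) : ℝ) : ℂ) + (((fun (V : GaugeConfig 3 L (Matrix.specialUnitaryGroup (Fin 2) ℂ))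 (q : Edge 3 L × Fin (fundamentalLatticeRep 2).N × Fin (fundamentalLatticeRep 2).N × Bool) => (fun z : ℂ => if q.2.2.2 then z.im else z.re) ((fundamentalRep (Fin 2) (V q.1) : Matrix (Fin 2) (Fin 2) ℂ) q.2.1 q.2.2.1)) V (ee, i, j, true) : ℝ) : ℂ) * Complex.I) q.1)) q.2.1 q.2.2.1) else 0)) *
          fderiv ℝ (fun z : (Edge 3 L × Fin (fundamentalLatticeRep 2).N × Fin (fundamentalLatticeRep 2).N × Bool → ℝ) => fderiv ℝ (fun y : (Edge 3 L × Fin (fundamentalLatticeRep 2).N × Fin (fundamentalLatticeRep 2).N × Bool → ℝ) => β' * ∑ p : Plaquette 3 L, (rootedLoop (fun (ee : Edge 3 L) (i j : Fin (fundamentalLatticeRep 2).N) => ((y (ee, i, j, false) : ℝ) : ℂ) + ((y (ee, i, j, true) : ℝ) : ℂ) * Complex.I) (p.1, p.2.1.1) p.2.1.2 false).trace.re) z (fun q : Edge 3 L × Fin (fundamentalLatticeRep 2).N × Fin (fundamentalLatticeRep 2).N × Bool => if m.1 = q.1 then (fun z : ℂ => if q.2.2.2 then z.im else z.re) (((Real.sqrt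 2 : ℂ) • ((fundamentalLatticeRep 2).lieProj (noiseDir m.2) * (fun (ee : Edge 3 L) => Matrix.of fun (i j : Fin (fundamentalLatticeRep 2).N) => ((z (ee, i, j, false) : ℝ) : ℂ) + ((z (ee, i, j, true) : ℝ) : ℂ) * Complex.I) q.1)) q.2.1 q.2.2.1) else 0)) ((fun (V : GaugeConfig 3 L (Matrix.specialUnitaryGroup (Fin 2) ℂ)) (q : Edge 3 L × Fin (fundamentalLatticeRep 2).N × Fin (fundamentalLatticeRep 2).N × Bool) => (fun z : ℂ => if q.2.2.2 then z.im else z.re) ((fundamentalRep (Fin 2) (V q.1) : Matrix (Fin 2) (Fin 2) ℂ) q.2.1 q.2.2.1)) V) (fun q : Edge 3 L × Fin (fundamentalLatticeRep 2).N × Fin (fundamentalLatticeRep 2).N × Bool => if n.1 = q.1 then (fun z : ℂ => if q.2.2.2 then z.im else z.re) (((Real.sqrt 2 : ℂ) • ((fundamentalLatticeRep 2).lieProj (noiseDir n.2) * (fun (ee : Edge 3 L) => Matrix.of fun (i j : Fin (fundamentalLatticeRep 2).N) => (((fun (V : GaugeConfig 3 L (Matrix.specialUnitaryGroup (Fin 2)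 ℂ)) (q : Edge 3 L × Fin (fundamentalLatticeRep 2).N × Fin (fundamentalLatticeRep 2).N × Bool) => (fun z : ℂ => if q.2.2.2 then z.im else z.re) ((fundamentalRep (Fin 2) (V q.1) : Matrix (Fin 2) (Fin 2) ℂ) q.2.1 q.2.2.1)) V (ee, i, j, false) : ℝ) : ℂ) + (((fun (V : GaugeConfig 3 L (Matrix.specialUnitaryGroup (Fin 2) ℂ)) (q : Edge 3 L × Fin (fundamentalLatticeRep 2).N × Fin (fundamentalLatticeRep 2).N × Bool) => (fun z : ℂ => if q.2.2.2 then z.im else z.re) ((fundamentalRep (Fin 2) (V q.1) : Matrix (Fin 2) (Fin 2) ℂ) q.2.1 q.2.2.1)) V (ee, i, j, true) : ℝ) : ℂ) * Complex.I) q.1)) q.2.1 q.2.2.1) else 0)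
        ≤ K₀ * ∑ n : Edge 3 L × NoiseIdx (fundamentalLatticeRep 2).N, (Λ (fun q : Edge 3 L × Fin (fundamentalLatticeRep 2).N × Fin (fundamentalLatticeRep 2).N × Bool => if n.1 = q.1 then (fun z : ℂ => if q.2.2.2 then z.im else z.re) (((Real.sqrt 2 : ℂ) • ((fundamentalLatticeRep 2).lieProj (noiseDir n.2) * (fun (ee : Edge 3 L) => Matrix.of fun (i j : Fin (fundamentalLatticeRep 2).N) => (((fun (V : GaugeConfig 3 L (Matrix.specialUnitaryGroup (Fin 2) ℂ)) (q : Edge 3 L × Fin (fundamentalLatticeRep 2).N × Fin (fundamentalLatticeRep 2).N × Bool) => (fun z : ℂ => if q.2.2.2 then z.im else z.re) ((fundamentalRep (Fin 2) (V q.1) : Matrix (Fin 2) (Fin 2) ℂ) q.2.1 q.2.2.1)) V (ee, i, j, false) : ℝ) : ℂ) + (((fun (V : GaugeConfig 3 L (Matrix.specialUnitaryGroup (Fin 2) ℂ)) (q : Edge 3 L × Fin (fundamentalLatticeRep 2).N × Fin (fundamentalLatticeRep 2).N × Bool) => (fun z : ℂ => if q.2.2.2 then z.im else z.re) ((fundamentalRep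 (Fin 2) (V q.1) : Matrix (Fin 2) (Fin 2) ℂ) q.2.1 q.2.2.1)) V (ee, i, j, true) : ℝ) : ℂ) * Complex.I) q.1)) q.2.1 q.2.2.1) else 0)) ^ 2))
    (κ : ℝ≥0 → Kernel (GaugeConfig 3 L (Matrix.specialUnitaryGroup (Fin 2) ℂ))
      (GaugeConfig 3 L (Matrix.specialUnitaryGroup (Fin 2) ℂ))) [∀ t, IsMarkovKernel (κ t)]
    (hreal : ∀ (t : ℝ≥0) (x : GaugeConfig 3 L (Matrix.specialUnitaryGroup (Fin 2) ℂ))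
        (Ω : Type) [MeasurableSpace Ω] (P : Measure Ω) [IsProbabilityMeasure P]
        (W : ℝ≥0 → Ω → (Edge 3 L × NoiseIdx 2 → ℝ)) (hW : IsFlatBrownian W P)
        (U : ℝ≥0 → Ω → GaugeConfig 3 L (Matrix.specialUnitaryGroup (Fin 2) ℂ)),
        (∀ ω, U 0 ω = x) →
        (latticeLangevinDynamics (fundamentalLatticeRep 2) β').IsSolution (fundamentalRep (Fin 2))
          hW.natFiltration P W U →
        κ t x = P.map (U t))
    {f : (Edge 3 L × Fin 2 × Fin 2 × Bool → ℝ) → ℝ} (hf : ContDiff ℝ 5 f) (t : ℝ≥0) {g' : (Edge 3 L × Fin 2 × Fin 2 × Bool → ℝ) → ℝ} (hg' : ContDiff ℝ 1 g') :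
    let coords : GaugeConfig 3 L (Matrix.specialUnitaryGroup (Fin 2) ℂ) → (Edge 3 L × Fin 2 × Fin 2 × Bool → ℝ) :=
      fun V q => (fun z : ℂ => if q.2.2.2 then z.im else z.re)
        ((fundamentalRep (Fin 2) (V q.1) : Matrix (Fin 2) (Fin 2) ℂ) q.2.1 q.2.2.1)
    let A : GaugeConfig 3 L (Matrix.specialUnitaryGroup (Fin 2) ℂ) → (Edge 3 L × Fin 2 × Fin 2 × Bool) →
        (Edge 3 L × Fin 2 × Fin 2 × Bool) → ℝ := fun V i j =>
      ∑ n : Edge 3 L × NoiseIdx 2,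
        (if n.1 = i.1 then (fun z : ℂ => if i.2.2.2 then z.im else z.re)
          ((latticeLangevinDynamics (fundamentalLatticeRep 2) β').noise
            (matrixConfig (fundamentalRep (Fin 2)) V) i.1 n.2 i.2.1 i.2.2.1) else 0) *
        (if n.1 = j.1 then (fun z : ℂ => if j.2.2.2 then z.im else z.re)
          ((latticeLangevinDynamics (fundamentalLatticeRep 2) β').noise
            (matrixConfig (fundamentalRep (Fin 2)) V) j.1 n.2 j.2.1 j.2.2.1) else 0)
    (∀ x, ∫ y, f (coords y) ∂(κ t x) = g' (coords x)) →
      ∀ x, Real.exp ((2 - K₀) * (t : ℝ)) * (∑ i : Edge 3 L × Fin 2 × Fin 2 × Bool, ∑ j : Edge 3 L × Fin 2 × Fin 2 × Bool, fderiv ℝ g' (coords x) (Pi.single i 1) * fderiv ℝ g' (coords x) (Pi.single j 1) * A x i j) ≤ ∫ y, (∑ i : Edge 3 L × Fin 2 × Fin 2 × Bool, ∑ j : Edge 3 L × Fin 2 × Fin 2 × Bool, fderiv ℝ f (coords y) (Pi.single i 1) * fderiv ℝ f (coords y) (Pi.single j 1) * A y i j) ∂(κ t x) := by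
  intro coords A hg'rep x
  classical
  obtain ⟨g, hg, -, hgrep, hb⟩ := wilson_carre_transition_le_of_hessBound L β' K₀ hHess κ hreal hf t
  have heq : ∀ V : (GaugeConfig 3 L (Matrix.specialUnitaryGroup (Fin 2) ℂ)), g' (coords V) = g (coords V) := fun V => by rw [← hg'rep V, ← hgrep V]
  obtain ⟨s, c, hs, -, -, -, -⟩ := exists_noiseFrame L
  have hW : ∀ n : Edge 3 L × NoiseIdx (fundamentalLatticeRep 2).N,
      fderiv ℝ g' (coords x) (fun q : Edge 3 L × Fin (fundamentalLatticeRep 2).N × Fin (fundamentalLatticeRep 2).N × Bool => if n.1 = q.1 then (fun z : ℂ => if q.2.2.2 then z.im else z.re) (((Real.sqrt 2 : ℂ) • ((fundamentalLatticeRep 2).lieProj (noiseDir n.2) * (fun (ee : Edge 3 L) => Matrix.of fun (i j : Fin (fundamentalLatticeRep 2).N) => ((coords x (ee, i, j, false) : ℝ) : ℂ) + ((coords x (ee, i, j, true) : ℝ) : ℂ) * Complex.I) q.1)) q.2.1 q.2.2.1) else 0) = fderiv ℝ g (coords x) (fun q : Edge 3 L × Fin (fundamentalLatticeRep 2).N ×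 Fin (fundamentalLatticeRep 2).N × Bool => if n.1 = q.1 then (fun z : ℂ => if q.2.2.2 then z.im else z.re) (((Real.sqrt 2 : ℂ) • ((fundamentalLatticeRep 2).lieProj (noiseDir n.2) * (fun (ee : Edge 3 L) => Matrix.of fun (i j : Fin (fundamentalLatticeRep 2).N) => ((coords x (ee, i, j, false) : ℝ) : ℂ) + ((coords x (ee, i, j, true) : ℝ) : ℂ) * Complex.I) q.1)) q.2.1 q.2.2.1) else 0) := fun n =>
    frameDeriv_eq_of_comp_coords_eq (L := L) n (hg'.differentiable (by norm_num)) (hg.differentiable (by norm_num)) heq x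
  have h1 : (∑ i : Edge 3 L × Fin 2 × Fin 2 × Bool, ∑ j : Edge 3 L × Fin 2 × Fin 2 × Bool, fderiv ℝ g' (coords x) (Pi.single i 1) * fderiv ℝ g' (coords x) (Pi.single j 1) * A x i j) =
      ∑ n : Edge 3 L × NoiseIdx (fundamentalLatticeRep 2).N, fderiv ℝ g' (coords x) (fun q : Edge 3 L × Fin (fundamentalLatticeRep 2).N × Fin (fundamentalLatticeRep 2).N × Bool => if n.1 = q.1 then (fun z : ℂ => if q.2.2.2 then z.im else z.re) (((Real.sqrt 2 : ℂ) • ((fundamentalLatticeRep 2).lieProj (noiseDir n.2) * (fun (ee : Edge 3 L) => Matrix.of fun (i j : Fin (fundamentalLatticeRep 2).N) => ((coords x (ee, i, j, false) : ℝ) : ℂ) + ((coords x (ee, i, j, true) : ℝ) : ℂ) * Complex.I) q.1)) q.2.1 q.2.2.1) else 0) * fderiv ℝ g' (coords x) (fun q : Edge 3 L × Fin (fundamentalLatticeRep 2).N × Fin (fundamentalLatticeRep 2).N × Bool => if n.1 = q.1 then (fun z : ℂ => if q.2.2.2 then z.im else z.re) (((Real.sqrt 2 : ℂ) • ((fundamentalLatticeRep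 2).lieProj (noiseDir n.2) * (fun (ee : Edge 3 L) => Matrix.of fun (i j : Fin (fundamentalLatticeRep 2).N) => ((coords x (ee, i, j, false) : ℝ) : ℂ) + ((coords x (ee, i, j, true) : ℝ) : ℂ) * Complex.I) q.1)) q.2.1 q.2.2.1) else 0) :=
    carre_eq_sum_frameDeriv_mul L β' g' g' x
  have h2 : (∑ i : Edge 3 L × Fin 2 × Fin 2 × Bool, ∑ j : Edge 3 L × Fin 2 × Fin 2 × Bool, fderiv ℝ g (coords x) (Pi.single i 1) * fderiv ℝ g (coords x) (Pi.single j 1) * A x i j) =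
      ∑ n : Edge 3 L × NoiseIdx (fundamentalLatticeRep 2).N, fderiv ℝ g (coords x) (fun q : Edge 3 L × Fin (fundamentalLatticeRep 2).N × Fin (fundamentalLatticeRep 2).N × Bool => if n.1 = q.1 then (fun z : ℂ => if q.2.2.2 then z.im else z.re) (((Real.sqrt 2 : ℂ) • ((fundamentalLatticeRep 2).lieProj (noiseDir n.2) * (fun (ee : Edge 3 L) => Matrix.of fun (i j : Fin (fundamentalLatticeRep 2).N) => ((coords x (ee, i, j, false) : ℝ) : ℂ) + ((coords x (ee, i, j, true) : ℝ) : ℂ) * Complex.I) q.1)) q.2.1 q.2.2.1) else 0) * fderiv ℝ g (coords x) (fun q : Edge 3 L × Fin (fundamentalLatticeRep 2).N × Fin (fundamentalLatticeRep 2).N × Bool => if n.1 = q.1 then (fun z : ℂ => if q.2.2.2 then z.im else z.re) (((Real.sqrt 2 : ℂ) • ((fundamentalLatticeRep 2).lieProj (noiseDir n.2) * (fun (ee : Edge 3 L) => Matrix.of fun (i j : Fin (fundamentalLatticeRep 2).N) => ((coords x (ee, i, j, false) : ℝ) : ℂ) + ((coords x (ee, i, j, true) : ℝ) : ℂ) *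 Complex.I) q.1)) q.2.1 q.2.2.1) else 0) :=
    carre_eq_sum_frameDeriv_mul L β' g g x
  have hΓ : (∑ i : Edge 3 L × Fin 2 × Fin 2 × Bool, ∑ j : Edge 3 L × Fin 2 × Fin 2 × Bool, fderiv ℝ g' (coords x) (Pi.single i 1) * fderiv ℝ g' (coords x) (Pi.single j 1) * A x i j) = (∑ i : Edge 3 L × Fin 2 × Fin 2 × Bool, ∑ j : Edge 3 L × Fin 2 × Fin 2 × Bool, fderiv ℝ g (coords x) (Pi.single i 1) * fderiv ℝ g (coords x) (Pi.single j 1) * A x i j) := by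
    rw [h1, h2]
    exact Finset.sum_congr rfl fun n _ => by rw [hW n]
  rw [hΓ]
  exact hb x

/-- ★★★ **Volume-uniform gradient bound for the SZZ semigroup at `|β'| < 1/12`** (Bakry–Émery; Shen–Zhu–Zhu Thm 4.2 / Cor. 4.4, gradient
form).  For EVERY torus size `L`, any realising Markov kernel family `κ`, every `C⁵` `f` and `t ≥ 0`: there is a `C³` compactly supported `g`
with `κ_t(f∘coords) = g∘coords` and `e^(2(1−12|β'|)t)·Γ^A(g)(x) ≤ κ_t(Γ^A f)(x)` for all `x` — i.e. `Γ(P_t f) ≤ e^(−2ρt) P_t Γf`,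
`ρ = 1 − 12|β'|`, a rate that does not depend on `L`. [cite: ShenZhuZhu2022, §4 Theorem 4.2 and Corollary 4.4] -/
theorem wilson_carre_transition_le_uniform (L : ℕ) [NeZero L] (β' : ℝ) (hβ : |β'| < 1 / 12)
    (κ : ℝ≥0 → Kernel (GaugeConfig 3 L (Matrix.specialUnitaryGroup (Fin 2) ℂ))
      (GaugeConfig 3 L (Matrix.specialUnitaryGroup (Fin 2) ℂ))) [∀ t, IsMarkovKernel (κ t)]
    (hreal : ∀ (t : ℝ≥0) (x : GaugeConfig 3 L (Matrix.specialUnitaryGroup (Fin 2) ℂ))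
        (Ω : Type) [MeasurableSpace Ω] (P : Measure Ω) [IsProbabilityMeasure P]
        (W : ℝ≥0 → Ω → (Edge 3 L × NoiseIdx 2 → ℝ)) (hW : IsFlatBrownian W P)
        (U : ℝ≥0 → Ω → GaugeConfig 3 L (Matrix.specialUnitaryGroup (Fin 2) ℂ)),
        (∀ ω, U 0 ω = x) →
        (latticeLangevinDynamics (fundamentalLatticeRep 2) β').IsSolution (fundamentalRep (Fin 2))
          hW.natFiltration P W U →
        κ t x = P.map (U t))
    {f : (Edge 3 L × Fin 2 × Fin 2 × Bool → ℝ) → ℝ} (hf : ContDiff ℝ 5 f) (t : ℝ≥0) :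
    let coords : GaugeConfig 3 L (Matrix.specialUnitaryGroup (Fin 2) ℂ) → (Edge 3 L × Fin 2 × Fin 2 × Bool → ℝ) :=
      fun V q => (fun z : ℂ => if q.2.2.2 then z.im else z.re)
        ((fundamentalRep (Fin 2) (V q.1) : Matrix (Fin 2) (Fin 2) ℂ) q.2.1 q.2.2.1)
    let A : GaugeConfig 3 L (Matrix.specialUnitaryGroup (Fin 2) ℂ) → (Edge 3 L × Fin 2 × Fin 2 × Bool) →
        (Edge 3 L × Fin 2 × Fin 2 × Bool) → ℝ := fun V i j =>
      ∑ n : Edge 3 L × NoiseIdx 2,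
        (if n.1 = i.1 then (fun z : ℂ => if i.2.2.2 then z.im else z.re)
          ((latticeLangevinDynamics (fundamentalLatticeRep 2) β').noise
            (matrixConfig (fundamentalRep (Fin 2)) V) i.1 n.2 i.2.1 i.2.2.1) else 0) *
        (if n.1 = j.1 then (fun z : ℂ => if j.2.2.2 then z.im else z.re)
          ((latticeLangevinDynamics (fundamentalLatticeRep 2) β').noise
            (matrixConfig (fundamentalRep (Fin 2)) V) j.1 n.2 j.2.1 j.2.2.1) else 0)
    ∃ g : (Edge 3 L × Fin 2 × Fin 2 × Bool → ℝ) → ℝ, ContDiff ℝ 3 g ∧ HasCompactSupport g ∧ (∀ x, ∫ y, f (coords y) ∂(κ t x) = g (coords x)) ∧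
      ∀ x, Real.exp (2 * (1 - 12 * |β'|) * (t : ℝ)) * (∑ i : Edge 3 L × Fin 2 × Fin 2 × Bool, ∑ j : Edge 3 L × Fin 2 × Fin 2 × Bool, fderiv ℝ g (coords x) (Pi.single i 1) * fderiv ℝ g (coords x) (Pi.single j 1) * A x i j) ≤ ∫ y, (∑ i : Edge 3 L × Fin 2 × Fin 2 × Bool, ∑ j : Edge 3 L × Fin 2 × Fin 2 × Bool, fderiv ℝ f (coords y) (Pi.single i 1) * fderiv ℝ f (coords y) (Pi.single j 1) * A y i j) ∂(κ t x) := by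
  intro coords A
  have _h := hβ
  have h := wilson_carre_transition_le_of_hessBound L β' (24 * |β'|) (wilson_hessBound L β') κ hreal hf t
  have e : (2 - 24 * |β'| : ℝ) = 2 * (1 - 12 * |β'|) := by ring
  rw [e] at h
  exact h

/-- ★★ **Exponential decay of the Lipschitz seminorm along the SZZ semigroup, uniformly in the volume.**  At `|β'| < 1/12`, for every `L`,
`κ`, `C⁵` `f` with `Γ^A(f) ≤ σ²` on the group and `t ≥ 0`: the representative `g` of `κ_t F` (so `g(coords x) = E f(coords U_t)` for EVERY
solution started at `x`) satisfies `Γ^A(g)(x) ≤ e^(−2(1−12|β'|)t)·σ²` at every `x` — no burn-in, no entropy or variance budget.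
[cite: BakryGentilLedoux2014, Thm 3.2.3 / (3.2.4)] -/
theorem wilson_lipschitz_contraction_uniform (L : ℕ) [NeZero L] (β' : ℝ) (hβ : |β'| < 1 / 12)
    (κ : ℝ≥0 → Kernel (GaugeConfig 3 L (Matrix.specialUnitaryGroup (Fin 2) ℂ))
      (GaugeConfig 3 L (Matrix.specialUnitaryGroup (Fin 2) ℂ))) [∀ t, IsMarkovKernel (κ t)]
    (hreal : ∀ (t : ℝ≥0) (x : GaugeConfig 3 L (Matrix.specialUnitaryGroup (Fin 2) ℂ))
        (Ω : Type) [MeasurableSpace Ω] (P : Measure Ω) [IsProbabilityMeasure P]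
        (W : ℝ≥0 → Ω → (Edge 3 L × NoiseIdx 2 → ℝ)) (hW : IsFlatBrownian W P)
        (U : ℝ≥0 → Ω → GaugeConfig 3 L (Matrix.specialUnitaryGroup (Fin 2) ℂ)),
        (∀ ω, U 0 ω = x) →
        (latticeLangevinDynamics (fundamentalLatticeRep 2) β').IsSolution (fundamentalRep (Fin 2))
          hW.natFiltration P W U →
        κ t x = P.map (U t))
    {f : (Edge 3 L × Fin 2 × Fin 2 × Bool → ℝ) → ℝ} (hf : ContDiff ℝ 5 f) {σ2 : ℝ} (t : ℝ≥0) :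
    let coords : GaugeConfig 3 L (Matrix.specialUnitaryGroup (Fin 2) ℂ) → (Edge 3 L × Fin 2 × Fin 2 × Bool → ℝ) :=
      fun V q => (fun z : ℂ => if q.2.2.2 then z.im else z.re)
        ((fundamentalRep (Fin 2) (V q.1) : Matrix (Fin 2) (Fin 2) ℂ) q.2.1 q.2.2.1)
    let A : GaugeConfig 3 L (Matrix.specialUnitaryGroup (Fin 2) ℂ) → (Edge 3 L × Fin 2 × Fin 2 × Bool) →
        (Edge 3 L × Fin 2 × Fin 2 × Bool) → ℝ := fun V i j =>
      ∑ n : Edge 3 L × NoiseIdx 2,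
        (if n.1 = i.1 then (fun z : ℂ => if i.2.2.2 then z.im else z.re)
          ((latticeLangevinDynamics (fundamentalLatticeRep 2) β').noise
            (matrixConfig (fundamentalRep (Fin 2)) V) i.1 n.2 i.2.1 i.2.2.1) else 0) *
        (if n.1 = j.1 then (fun z : ℂ => if j.2.2.2 then z.im else z.re)
          ((latticeLangevinDynamics (fundamentalLatticeRep 2) β').noise
            (matrixConfig (fundamentalRep (Fin 2)) V) j.1 n.2 j.2.1 j.2.2.1) else 0)
    (∀ y, (∑ i : Edge 3 L × Fin 2 × Fin 2 × Bool, ∑ j : Edge 3 L × Fin 2 × Fin 2 × Bool, fderiv ℝ f (coords y) (Pi.single i 1) * fderiv ℝ f (coords y) (Pi.single j 1) * A y i j) ≤ σ2) →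
    ∃ g : (Edge 3 L × Fin 2 × Fin 2 × Bool → ℝ) → ℝ, ContDiff ℝ 3 g ∧ HasCompactSupport g ∧ (∀ x, ∫ y, f (coords y) ∂(κ t x) = g (coords x)) ∧
      ∀ x, (∑ i : Edge 3 L × Fin 2 × Fin 2 × Bool, ∑ j : Edge 3 L × Fin 2 × Fin 2 × Bool, fderiv ℝ g (coords x) (Pi.single i 1) * fderiv ℝ g (coords x) (Pi.single j 1) * A x i j) ≤ Real.exp (-(2 * (1 - 12 * |β'|) * (t : ℝ))) * σ2 := by
  intro coords A hσ
  obtain ⟨g, hg, hgc, hgrep, hbound⟩ := wilson_carre_transition_le_uniform L β' hβ κ hreal hf t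
  refine ⟨g, hg, hgc, hgrep, fun x => ?_⟩
  haveI : IsProbabilityMeasure (κ t x) := IsMarkovKernel.isProbabilityMeasure x
  have h1 := hbound x
  have h2 : ∫ y, (∑ i : Edge 3 L × Fin 2 × Fin 2 × Bool, ∑ j : Edge 3 L × Fin 2 × Fin 2 × Bool, fderiv ℝ f (coords y) (Pi.single i 1) * fderiv ℝ f (coords y) (Pi.single j 1) * A y i j) ∂(κ t x) ≤ σ2 := by
    calc ∫ y, (∑ i : Edge 3 L × Fin 2 × Fin 2 × Bool, ∑ j : Edge 3 L × Fin 2 × Fin 2 × Bool, fderiv ℝ f (coords y) (Pi.single i 1) * fderiv ℝ f (coords y) (Pi.single j 1) * A y i j) ∂(κ t x) ≤ ∫ _y, σ2 ∂(κ t x) :=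
          integral_mono_of_nonneg (ae_of_all _ fun y => ?_) (integrable_const _) (ae_of_all _ fun y => hσ y)
      _ = σ2 := by simp
    -- `Γ^A(f) ≥ 0` (a sum of squares along the frame)
    show 0 ≤ (∑ i : Edge 3 L × Fin 2 × Fin 2 × Bool, ∑ j : Edge 3 L × Fin 2 × Fin 2 × Bool, fderiv ℝ f (coords y) (Pi.single i 1) * fderiv ℝ f (coords y) (Pi.single j 1) * A y i j)
    have h : (∑ i : Edge 3 L × Fin 2 × Fin 2 × Bool, ∑ j : Edge 3 L × Fin 2 × Fin 2 × Bool, fderiv ℝ f (coords y) (Pi.single i 1) * fderiv ℝ f (coords y) (Pi.single j 1) * A y i j) =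
        ∑ n : Edge 3 L × NoiseIdx (fundamentalLatticeRep 2).N, fderiv ℝ f (coords y) (fun q : Edge 3 L × Fin (fundamentalLatticeRep 2).N × Fin (fundamentalLatticeRep 2).N × Bool => if n.1 = q.1 then (fun z : ℂ => if q.2.2.2 then z.im else z.re) (((Real.sqrt 2 : ℂ) • ((fundamentalLatticeRep 2).lieProj (noiseDir n.2) * (fun (ee : Edge 3 L) => Matrix.of fun (i j : Fin (fundamentalLatticeRep 2).N) => ((coords y (ee, i, j, false) : ℝ) : ℂ) + ((coords y (ee, i, j, true) : ℝ) : ℂ) * Complex.I) q.1)) q.2.1 q.2.2.1) else 0) * fderiv ℝ f (coords y) (fun q : Edge 3 L × Fin (fundamentalLatticeRep 2).N × Fin (fundamentalLatticeRep 2).N × Bool => if n.1 = q.1 then (fun z : ℂ => if q.2.2.2 then z.im else z.re) (((Real.sqrt 2 : ℂ) • ((fundamentalLatticeRep 2).lieProj (noiseDir n.2) * (fun (ee : Edge 3 L) => Matrix.of fun (i j : Fin (fundamentalLatticeRep 2).N) => ((coords y (ee, i, j, false) : ℝ) : ℂ) + ((coords y (ee, i, j, true) : ℝ) : ℂ) *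 Complex.I) q.1)) q.2.1 q.2.2.1) else 0) :=
      carre_eq_sum_frameDeriv_mul L β' f f y
    rw [h]
    exact Finset.sum_nonneg fun n _ => mul_self_nonneg _
  have hexp : 0 < Real.exp (2 * (1 - 12 * |β'|) * (t : ℝ)) := Real.exp_pos _
  rw [Real.exp_neg]
  rw [le_inv_mul_iff₀ hexp]
  exact h1.trans h2

end Summit.QuantumFields.YangMills.Theorems.ColdStartUniversality
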